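import Mathlib
import Summits.Ventures.HodgeRepro.Tier4.Target
import Summits.Ventures.HodgeRepro.Tier4.TargetV3
import Summits.Ventures.HodgeRepro.Tier4.Common.TargetDataV3
import Summits.Ventures.HodgeRepro.Tier4.Common.ConcreteCocompact
import Summits.Ventures.HodgeRepro.Tier4.Line1.RealisedDatum
import Summits.Ventures.HodgeRepro.Tier4.Line1.IdentificationSplit
import Summits.Ventures.HodgeRepro.Tier4.Line1.InstanceDisplay
import Summits.Ventures.HodgeRepro.Tier4.Line1.InstanceDisplayMin

/-!
# Tier4/Line1/CloseForm — LINE L1's CLOSE FORM (lead g387 RULING R-38, S15981, after OPS L8012 10:33:20Z)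

Blind re-derivation cell `pub-hodge-repro`, Tier 4 (README §9–§10), seat t4-plan-1 (gen 4).  HOME file under the skeleton's
certificate regime (farm by name, never the gate): proofs/t4-plan-1/Tier4/Line1/CloseForm.lean.  Line of record: the FILED
skeleton Tier4/Line1/Skeleton.lean v0.47 (sha256 3e68636b382872a6db2c06772204dfb3803a33c25c0d1f21a4cd9bb285a936a3 · 3141, FILED
S14919).  Imports TREE modules only (the skeleton is HOME-only and is not imported): the targets `P_T4` / `P_T4v3` (typer-1
Target / TargetV3, `P_T4v3_of_forall` TargetDataV3), the realised datum `Datum4` with `Datum4.conclusion_of_content` (t4-L1-p3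
RealisedDatum), `TargetData.isCocompact_of_BHC` (typer-1 ConcreteCocompact p669425, on lit-3's
`Lit.BorelHarishChandra1962_Thm11_8_cocompact_hdef`, LitCompactness v0.3 p662946), the seesaw identity `HodgePairingEqJ`
(IdentificationSplit) and the tree twin of the minimal display `P_T4v3_of_instance_displayed_min` (t4-L1-p1 InstanceDisplayMin
p697651 on t4-L1-p5 InstanceDisplay p696781).

THE CLOSE FORM (R-38 (2)): one `def Input_<Name> : Prop := <the statement of each declared sorry in the cone of the line's
target theorem, VERBATIM>` per sorried declaration the target's proof consumes, and `theorem <target>_of_inputs (h₁ : Input_…)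
… : P_T4v3` = the skeleton's assembly replayed with `hᵢ` in place of the sorried names, CERTIFIED `--axioms` = [propext,
Classical.choice, Quot.sound], 0 sorries.

THE CONE OF L1's TARGET THEOREM.  The line's target theorem of record is `target_L1_v3 : P_T4v3` (Skeleton v0.47 L3016–L3021;
THE RECORD OF THE LINE from v0.41).  Its proof consumes EXACTLY ONE sorried declaration: the v3 costume `line1_realise_v3`
(Skeleton L2996–L3000), through the tree's `P_T4v3_of_forall`, `Datum4.conclusion_of_content`, `IsAlbaneseLift.mono` and the
skeleton's 6-line glue `TargetData.N2.mono` (replicated below as `n2_mono`).  The other sorried declaration of the skeleton,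
`line1_realise` (L1019), is consumed by `target_L1 : P_T4` only — the frozen `P_T4` record (false on paper at X₃, p673864) — and
lies OUTSIDE the cone of `target_L1_v3`: it is NOT an input (as `mixed_classes_pair` for L4 in R-38 (2)).

* `Input_line1_realise_v3` — the statement of `line1_realise_v3` VERBATIM, closed over the skeleton's section variables `F E`
  (and their instances).  INPUT CENSUS ROW: **NOT A PRINT — open mathematics** (the disclosed costume: for every datum a
  deeper level `Γ'`, an N2-compatible quadruple `a'` of Albanese lifts at `Γ'`, and the realised datum of the RTF line for
  the re-levelled datum; its content is the residual display below, with (S1a), `hM`, `hPA`/`hPA'` PRINT-shaped, CENSUS v26.6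
  §B).
* `target_L1_v3_of_inputs (h₁ : Input_line1_realise_v3) : P_T4v3` — `target_L1_v3`'s assembly replayed, sorry-free.

THE RESIDUAL OF RECORD AS A SECOND CLOSE FORM (plan-1 g4's crossing S16019 to R-38; the lead's call whether the CLOSE line cites
it).  The FILED skeleton also holds `target_L1_v3_of_display_min_BHC (hBHC) (h) : P_T4v3` (L3092–L3135, trio by name), whose two
hypotheses are the residual of record (CENSUS v26.6): the PRINT `hBHC` and the minimal display `h`.  Restated here on TREE
names, in the tree twin's explicit-clause form (the skeleton's `InstanceHeckeData` packing of row (6) is HOME-only; the two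
forms are the same display by `instance_display_min_of_skeleton`, Skeleton L2822):
* `Input_BHC_W42` — the printed Borel–Harish-Chandra / Godement cocompactness for every datum's `(E, H, τ₀, C)`:
  `Lit.BorelHarishChandra1962_Thm11_8_cocompact_hdef E d.H d.τ₀ d.C`.  INPUT CENSUS ROW: **PRINT** — Borel–Harish-Chandra,
  Ann. of Math. 75 (1962) Thm 11.8 (lit-3's typed Prop, LitCompactness v0.3 p662946 commit dfabf7891657; WANTED W42 at the
  operator; secondary Witte Morris arXiv:math/0106063).  It narrows the display's former `hcc` clause (v0.46 → v0.47).
* `Input_display_min hBHC` — the minimal display WITHOUT its `hcc` clause (the cocompactness at `Γ'` is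
  `isCocompact_of_BHC` on the re-levelled datum), i.e. the hypothesis `h` of `target_L1_v3_of_display_min_BHC` in the tree
  twin's vocabulary: per datum the level `Γ'` + `N2` (DATA), the totally definite genuine plane with torus data and the four
  character clauses (DATA), one adapted ONB and one isolating pair with its five J2 clauses (BY NAME on the tree for the
  instance, t4-L1-p4), the content — a level `N ≠ 0` with a K-type `σ` (DATA), Hecke test pairs `tf` with the seesaw identity
  (S1a) `HodgePairingEqJ` (PRINT shape), and row (6): `hM` multiplicity one of the cores (PRINT: Mœglin 2011 / Mœglin–Renard
  2019 / Chen–Zou 2025, rows I-t4-lit-6-44/45/47), `hPA`/`hPA'` the test-vector clauses (PRINT/TYPER: Gross–Prasad 1991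
  Props 2.3/2.6 under (2.1) + a level condition, row I-t4-lit-1-73; the antecedent `PeriodNonzeroT` is the tree's
  `atoms_of_specBlock_ne_zero`), `hreal` the dictionary (DATA).  INPUT CENSUS ROW as ONE Prop: **NOT A PRINT — open
  mathematics** (a conjunction of DATA and PRINT-shaped clauses; no single printed sentence asserts it).
* `target_L1_v3_of_display_inputs (hBHC : Input_BHC_W42) (h : Input_display_min hBHC) : P_T4v3` — re-pack the witness with
  `hcc := isCocompact_of_BHC …` and apply the tree twin `P_T4v3_of_instance_displayed_min` (the skeleton's V47 proof, on the
  tree twin instead of `target_L1_v3_of_display_min_tree`).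

WHAT THIS DOES AND DOES NOT CLAIM (R-38 (4)): both theorems are sorry-free theorems `Inputs → P_T4v3`; each form has a
NOT-A-PRINT input, so there is NO claim on `P_T4v3`.  Nothing in the FILED skeleton changes.  HC_CM is NOT proved by anyone
in this repository.
-/

set_option autoImplicit false

noncomputable section

namespace Summit.Ventures.HodgeRepro.Tier4.Line1.CloseForm

open NumberField Common MeasureTheory Topology RTF RTF.Setting Matrix

/-- **INPUT 1 — the statement of the ONE sorried declaration in the cone of `target_L1_v3`, VERBATIM** (`line1_realise_v3`,
Skeleton v0.47 L2996–L3000, closed over the section variables `F E`).  Census row: NOT A PRINT — open mathematics. -/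
def Input_line1_realise_v3 : Prop :=
  ∀ (F E : Type) [Field F] [NumberField F] [IsGalois ℚ F] [IsCMField F] [Field E] [NumberField E]
      [IsGalois ℚ E] [IsCMField E] (d : TargetData F E),
  ∃ (Γ' : Set (Matrix (Fin 3) (Fin 3) E)) (hΓ' : d.IsLevel Γ') (a' : ∀ i : Fin 4, (Fin 2 → ℂ) → (↥(d.T i) → ℂ))
    (ha' : ∀ i, IsAlbaneseLift (d.T i) (d.Λ i) d.τ₀ d.C Γ' (a' i)),
    (d.relevel Γ' hΓ'.1 a' ha').N2 ∧ ∃ Y : Datum4 (d.relevel Γ' hΓ'.1 a' ha'), Y.Content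

section N2

variable {F E : Type} [Field F] [NumberField F] [IsGalois ℚ F] [IsCMField F]
variable [Field E] [NumberField E] [IsGalois ℚ E] [IsCMField E]

/-- N2 DESCENDS TO DEEPER LEVELS (the skeleton's glue `TargetData.N2.mono`, v0.41, replicated verbatim). -/
theorem n2_mono (d : TargetData F E) {Γ' Γ'' : Set (Matrix (Fin 3) (Fin 3) E)}
    (hΓ' : IsCongruenceSubgroup (IsCMField.complexConj E).toRingEquiv d.H Γ')
    (hΓ'' : IsCongruenceSubgroup (IsCMField.complexConj E).toRingEquiv d.H Γ'')
    (a' : ∀ i : Fin 4, (Fin 2 → ℂ) → (↥(d.T i) → ℂ)) (ha' : ∀ i, IsAlbaneseLift (d.T i) (d.Λ i) d.τ₀ d.C Γ' (a' i))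
    (ha'' : ∀ i, IsAlbaneseLift (d.T i) (d.Λ i) d.τ₀ d.C Γ'' (a' i)) (hsub : Γ'' ⊆ Γ')
    (h : (d.relevel Γ' hΓ' a' ha').N2) : (d.relevel Γ'' hΓ'' a' ha'').N2 :=
  fun N hN hsub' γ hγ => h N hN (hsub'.trans hsub) γ hγ

end N2

/-- **L1's CLOSE FORM (R-38 (2))**: `target_L1_v3`'s assembly (Skeleton L3016–L3021) replayed with `h₁ F E d` in place of the
sorried `line1_realise_v3 d` — the relevelled datum's `conclusion` (`Datum4.conclusion_of_content`) yields a level `Γ'' ≤ Γ'`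
with Hecke elements and a domain; the lifts and N2 descend to `Γ''`.  Sorry-free; axioms = the trio. -/
theorem target_L1_v3_of_inputs (h₁ : Input_line1_realise_v3) : P_T4v3 :=
  P_T4v3_of_forall fun F E _ _ _ _ _ _ _ _ d => by
    obtain ⟨Γ', hΓ', a', ha', hN2, Y, hY⟩ := h₁ F E d
    obtain ⟨Γ'', hΓ''c, hsub, h, hh, D, hD, hne⟩ := Y.conclusion_of_content hY
    exact ⟨Γ'', ⟨hΓ''c, hsub.trans hΓ'.2⟩, a', fun i => (ha' i).mono hsub,
      n2_mono d hΓ'.1 hΓ''c a' ha' (fun i => (ha' i).mono hsub) hsub hN2, h, hh, D, hD, hne⟩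

/-- **INPUT 2 — THE PRINT (W42)**: Borel–Harish-Chandra 1962 Thm 11.8 / Godement's compactness criterion, SPECIALISED by lit-3 to
the datum's `(E, H, τ₀, C)` (`Lit.BorelHarishChandra1962_Thm11_8_cocompact_hdef`, LitCompactness v0.3 p662946), for every
datum.  Census row: PRINT (cite-only; WANTED W42). -/
def Input_BHC_W42 : Prop :=
  ∀ (F E : Type) [Field F] [NumberField F] [IsGalois ℚ F] [IsCMField F] [Field E] [NumberField E]
      [IsGalois ℚ E] [IsCMField E] (d : TargetData F E),
    Lit.BorelHarishChandra1962_Thm11_8_cocompact_hdef E d.H d.τ₀ d.C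

/-- **INPUT 3 — THE MINIMAL DISPLAY WITHOUT ITS `hcc` CLAUSE** (the hypothesis `h` of the skeleton's
`target_L1_v3_of_display_min_BHC`, Skeleton L3096–L3134, in the tree twin's explicit-clause vocabulary — the clauses of
`P_T4v3_of_instance_displayed_min`, InstanceDisplayMin L48–L98, with `hcc := isCocompact_of_BHC (hBHC …) isLevel_self`).
Census row as one Prop: NOT A PRINT — open mathematics (DATA + the PRINT-shaped clauses (S1a), `hM`, `hPA`/`hPA'`; CENSUS
v26.6 §B). -/
def Input_display_min (hBHC : Input_BHC_W42) : Prop :=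
    ∀ (F E : Type) [Field F] [NumberField F] [IsGalois ℚ F] [IsCMField F]
      [Field E] [NumberField E] [IsGalois ℚ E] [IsCMField E] (d : TargetData F E),
      ∃ (Γ' : Set (Matrix (Fin 3) (Fin 3) E)) (hΓ' : d.IsLevel Γ') (a' : ∀ i : Fin 4, (Fin 2 → ℂ) → (↥(d.T i) → ℂ))
        (ha' : ∀ i, IsAlbaneseLift (d.T i) (d.Λ i) d.τ₀ d.C Γ' (a' i)),
        (d.relevel Γ' hΓ'.1 a' ha').N2 ∧
        ∃ (k : Type) (_ : Field k) (_ : NumberField k) (pl : PlaneData k) (hdef : IsDefinite pl)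
          (hgen : IsGenuineRow pl) (_ : MeasurableSpace (GA pl)) (_ : BorelSpace (GA pl)) (R : RTFData pl)
          (μ : Measure (GA pl)) (_ : μ.IsHaarMeasure) (_ : R.μT.IsHaarMeasure) (_ : R.μT'.IsHaarMeasure)
          (hT : IsCompact (closure R.DT)) (hT' : IsCompact (closure R.DT')) (htot : IsTotallyDefinite pl)
          (_ : Continuous R.chi) (_ : ∀ a, ‖R.chi a‖ = 1) (_ : Continuous R.chi') (_ : ∀ a, ‖R.chi' a‖ = 1)
          (τ : ℕ → Set (GA pl → ℂ)) (φ : ℕ → GA pl → ℂ) (n : ℕ → ℕ)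
          (hB : (Setting.ofAdelic pl hdef hgen R μ hT hT').IsAdaptedONB τ φ n)
          (f₁ f₂ : GA pl → ℂ) (o₀ : (Setting.ofAdelic pl hdef hgen R μ hT hT').Orbit),
          RTF.IsTest f₁ ∧ RTF.IsTest f₂ ∧ RTF.IsTest ((Setting.ofAdelic pl hdef hgen R μ hT hT').conv f₁ f₂) ∧
          (Setting.ofAdelic pl hdef hgen R μ hT hT').geoSupport
            ((Setting.ofAdelic pl hdef hgen R μ hT hT').conv f₁ f₂) = {o₀} ∧
          (Setting.ofAdelic pl hdef hgen R μ hT hT').orbital R.chi R.chi' o₀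
            ((Setting.ofAdelic pl hdef hgen R μ hT hT').conv f₁ f₂) ≠ 0 ∧
          ∃ (N : ℕ) (hN : N ≠ 0)
            (tf : ((d.relevel Γ' hΓ'.1 a' ha').concreteWitness (d.relevel Γ' hΓ'.1 a' ha').isLevel_self
              (isDomain_dom _ (d.relevel Γ' hΓ'.1 a' ha').isLevel_self).subset_ball
              (isDomain_dom _ (d.relevel Γ' hΓ'.1 a' ha').isLevel_self).measurableSet
              ((d.relevel Γ' hΓ'.1 a' ha').residual_of_cocompact (d.relevel Γ' hΓ'.1 a' ha').isLevel_self
                ((d.relevel Γ' hΓ'.1 a' ha').isCocompact_of_BHC (hBHC F E (d.relevel Γ' hΓ'.1 a' ha'))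
                  (d.relevel Γ' hΓ'.1 a' ha').isLevel_self))).Translates → (GA pl → ℂ) × (GA pl → ℂ))
            (dσ : ℕ) (σ : archImageLevel pl N →* Matrix (Fin dσ) (Fin dσ) ℂ) (hσc : Continuous σ)
            (hσu : ∀ u, (σ u).conjTranspose * σ u = 1)
            (hσirr : ∀ U : Submodule ℂ (Fin dσ → ℂ), (∀ u, ∀ v ∈ U, (σ u).mulVec v ∈ U) → U = ⊥ ∨ U = ⊤),
            (∀ γ, RTF.IsTest (tf γ).1) ∧ (∀ γ, RTF.IsTest (tf γ).2) ∧
            HodgePairingEqJ (Setting.ofAdelic pl hdef hgen R μ hT hT') R.chi R.chi' tf ∧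
            (∀ i j : ↥(instanceSupport pl hdef hgen R μ hT hT' htot hN σ hσc hσu hB), i ≠ j →
              ¬ (Setting.ofAdelic pl hdef hgen R μ hT hT').IsoRep
                (instanceCore pl hdef hgen R μ hT hT' htot hN σ hσc hσu hσirr hB i)
                (instanceCore pl hdef hgen R μ hT hT' htot hN σ hσc hσu hσirr hB j)) ∧
            (∀ m, (Setting.ofAdelic pl hdef hgen R μ hT hT').PeriodNonzeroT R.chi (τ m) →
              ∃ w ∈ RTF.Setting.blockAdmissible τ m
                (RTF.Setting.isotypicFixed (Setting.ofAdelic pl hdef hgen R μ hT hT') (finLevel pl N)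
                  (instanceType pl N σ) (isOpen_finLevel pl hN) (isCompact_finLevel_of_totallyDefinite pl htot hN)
                  (continuous_instanceType pl N σ hσc)),
                (Setting.ofAdelic pl hdef hgen R μ hT hT').periodT R.chi (fun t => w t) ≠ 0) ∧
            (∀ m, (Setting.ofAdelic pl hdef hgen R μ hT hT').PeriodNonzeroT' R.chi' (τ m) →
              ∃ w' ∈ RTF.Setting.blockAdmissible τ m
                (RTF.Setting.isotypicFixed (Setting.ofAdelic pl hdef hgen R μ hT hT') (finLevel pl N)
                  (instanceType pl N σ) (isOpen_finLevel pl hN) (isCompact_finLevel_of_totallyDefinite pl htot hN)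
                  (continuous_instanceType pl N σ hσc)),
                (Setting.ofAdelic pl hdef hgen R μ hT hT').periodT' R.chi' (fun t' => w' t') ≠ 0) ∧
            RealisedHecke (Setting.ofAdelic pl hdef hgen R μ hT hT') R.chi R.chi' φ n tf
              (RTF.Setting.HeckeAlg (Setting.ofAdelic pl hdef hgen R μ hT hT') (finLevel pl N)
                (instanceType pl N σ) (isOpen_finLevel pl hN) (isCompact_finLevel_of_totallyDefinite pl htot hN)
                (continuous_instanceType pl N σ hσc) (isIrreducibleRep_instanceType pl N σ hσirr))
              (fun t => (t : GA pl → ℂ))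

/-- **THE RESIDUAL OF RECORD AS A CLOSE FORM** (the skeleton's `target_L1_v3_of_display_min_BHC`, v0.47 L3092–L3135, on the tree
twin): re-pack the witness with `hcc := (d.relevel …).isCocompact_of_BHC (hBHC F E (d.relevel …)) (d.relevel …).isLevel_self`
and apply `P_T4v3_of_instance_displayed_min`.  Sorry-free; axioms = the trio. -/
theorem target_L1_v3_of_display_inputs (hBHC : Input_BHC_W42) (h : Input_display_min hBHC) : P_T4v3 :=
  P_T4v3_of_instance_displayed_min fun F E _ _ _ _ _ _ _ _ d => by
    obtain ⟨Γ', hΓ', a', ha', hN2, rest⟩ := h F E d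
    exact ⟨Γ', hΓ', a', ha', hN2,
      (d.relevel Γ' hΓ'.1 a' ha').isCocompact_of_BHC (hBHC F E (d.relevel Γ' hΓ'.1 a' ha'))
        (d.relevel Γ' hΓ'.1 a' ha').isLevel_self, rest⟩

end Summit.Ventures.HodgeRepro.Tier4.Line1.CloseForm

end
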